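import Summits.SmoothPoincare4.SmoothPoincare4.Theses.EntropyRung
import Summits.SmoothPoincare4.SmoothPoincare4.Theorems.EntropyRungNoncompactShrinkerGapReduction
import Summits.SmoothPoincare4.SmoothPoincare4.Theorems.EntropyRungNoncompactShrinkerGapStubThreeShrinkerGap
import Summits.SmoothPoincare4.SmoothPoincare4.Theorems.EntropyRungNoncompactShrinkerGapStubModelValueSplitLineOfNonneg
import Summits.SmoothPoincare4.SmoothPoincare4.Theorems.EntropyRungNoncompactShrinkerGapStubTransplantComparison
import Summits.SmoothPoincare4.SmoothPoincare4.Theorems.EntropyRungNoncompactShrinkerGapStubShrinkerLSIFiniteFisher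
import Summits.SmoothPoincare4.SmoothPoincare4.Theorems.EntropyRungNoncompactShrinkerGapStubCompactSupportLSIOfLSI
import Summits.SmoothPoincare4.SmoothPoincare4.Theorems.EntropyRungNoncompactShrinkerGapCarrilloNiClauses
import Summits.SmoothPoincare4.SmoothPoincare4.Theorems.EntropyRungNoncompactShrinkerGapBakryEmeryLSI
import Literature.Geometry.Riemannian.BakryEmeryLogSobolev
import Literature.Geometry.Riemannian.ThreeShrinkerClassification
import Literature.Geometry.Riemannian.ShrinkerSplittingAtInfinity
import Literature.Geometry.Riemannian.ShrinkerScalarCurvatureNonnegHolds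

/-!
# `EntropyRung.NoncompactShrinkerGap` (stmt-SmoothPoincare4-10868): the reduction of line `collapsed-ends-usc`,
# v9 — keyed by THREE published theorems: the 3-d classification, splitting at infinity, and the TEXTBOOK
# Bakry–Émery logarithmic Sobolev inequality

This is the composition of skeleton v9 of the line (`Cruxes/NoncompactShrinkerGap/Lines/collapsed_ends_usc.lean`)
landed as two registered helpers, superseding the antecedents of the landed v5 reduction
(`EntropyRungNoncompactShrinkerGapReduction.lean`, p96558: `F3 → F1 → F2 → CN → …`):

* `helper_nonDecayingGap_of_textbook` — **the crux on the bounded-curvature non-conical class**, modulo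
  F3 `threeShrinkerClassification_modelData` (Munteanu–Wang 2019 Thm 1.2 / Cao–Chen–Zhu 2008), F1
  `shrinkerSplittingAtInfinity_four` (MW15 Thm 1 + EMT11 Thm 1.4 + Naber 2010 Lemma 4.1 + B–B25 Thm 1.8) and BE-text
  = the Bakry–Émery LSI of a complete `CD(K,∞)` weighted manifold WRITTEN OUT (filed as the Literature named fact
  `bakryEmery_logSobolev_complete`, p116121; Bakry–Émery
  1985; Carrillo–Ni 2009 Thm 3.1; Bakry–Gentil–Ledoux 2014 Prop 5.7.1): a complete connected non-compact non-flat
  normalised 4-d gradient shrinker whose scalar curvature is bounded and does not decay at infinity has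
  `∫ e^{-f} dV ≤ 32π²√π e^{-3/2} = (4π)² Θ(S³×ℝ)`. Compared with v5 the Haslhofer–Müller growth fact F2 is GONE
  (its only used clause, (2.6) `R ≥ 0`, is the theorem `shrinkerScalarCurvature_nonneg_holds`) and the
  Carrillo–Ni package CN is REPLACED by the textbook LSI (clauses (i), (iii) are theorems —
  `EntropyRungNoncompactShrinkerGapCarrilloNiClauses.lean`; clause (ii) at finite Fisher information is
  `stub_shrinkerLSI_ff_of_bakryEmery` ∘ `helper_bakryEmeryLSI_of_logSobolev`; U1 is re-landed over it,
  `stub_compactSupportLSI_of_lsi`).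
* `helper_noncompactShrinkerGap_of_textbook` — **the crux itself** from the same three facts and the two residues
  `ConicalGap` (the asymptotically conical class: `R → 0` at infinity) and `UnboundedCurvatureGap` (`sup R = ∞`),
  which are the recognised open core of the problem (both are special cases of the crux:
  `conicalGap_of_noncompactShrinkerGap`, `unboundedCurvatureGap_of_noncompactShrinkerGap` in the v5 file).

Everything here is glue over landed files; no definition and no named fact is introduced.
-/

noncomputable section

-- `Summit.SmoothPoincare4.SmoothPoincare4.…` (summit = problem) trips `dupNamespace` on every decl.
set_option linter.dupNamespace false

open scoped Manifold ContDiff ENNReal NNReal Topology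
open MeasureTheory Set Filter
open Literature.Geometry.Lorentzian Literature.Geometry.Riemannian

namespace Summit.SmoothPoincare4.SmoothPoincare4.Theorems.NoncompactShrinkerGapReductionTextbook

open Summit.SmoothPoincare4.SmoothPoincare4.Theorems.NoncompactShrinkerGapReduction
open Summit.SmoothPoincare4.SmoothPoincare4.Theorems

/-- **Carrillo–Ni clause (ii) at finite Fisher information, from the textbook LSI** (W1 ∘ BE-instance). -/
theorem shrinkerLSI_ff (hBE : bakryEmery_logSobolev_complete) : ∀ (n : ℕ) (M : Type) [TopologicalSpace M] [T2Space M] [SecondCountableTopology M] [ChartedSpace (EuclideanSpace ℝ (Fin n)) M] [IsManifold (𝓡 n) ∞ M] [ConnectedSpace M] [T3Space M] [MeasurableSpace M] [BorelSpace M] (g : PseudoRiemannianMetric (𝓡 n) ∞ (EuclideanSpace ℝ (Fin n)) (TangentSpace (𝓡 n) : M → Type _)) [g.HasLeviCivita] (f : M → ℝ) (hg : g.IsRiemannian), (∀ (x : M) (r : NNReal), IsCompact {y : M | g.edist hg x y ≤ r}) → ContMDiff (𝓡 n) 𝓘(ℝ, ℝ) ∞ f → (∀ (x : M) (X Y : TangentSpace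 (𝓡 n) x), g.ricci x X Y + g.hessian f x X Y = (1 / 2 : ℝ) * g.val x X Y) → (∀ x : M, g.scalarCurvature x + g.gradSq f x = f x) → ∀ ψ : M → ℝ, ContMDiff (𝓡 n) 𝓘(ℝ, ℝ) ∞ ψ → g.IsEntropyCompatible ψ 1 → (∃ o : M, Integrable (fun x ↦ (g.riemEDist o x).toReal ^ 2 * entropyDensity n ψ 1 x) g.riemVolume) → Integrable (fun x ↦ ((g.scalarCurvature x + g.gradSq ψ x) + ψ x - n) * entropyDensity n ψ 1 x) g.riemVolume → Integrable (fun x ↦ g.gradSq ψ x * entropyDensity n ψ 1 x) g.riemVolume → Real.log ((4 * Real.pi) ^ (-(n : ℝ) / 2) * ∫ x, Real.exp (-f x) ∂g.riemVolume) ≤ g.wEntropy g.leviCivita ψ 1 :=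
  NoncompactShrinkerGapShrinkerLSIFiniteFisher.stub_shrinkerLSI_ff_of_bakryEmery
    (NoncompactShrinkerGapBakryEmeryLSI.helper_bakryEmeryLSI_of_logSobolev hBE)

/-- **The lever** (Bernstein–Wang 2016 Thm 1.2 transplanted), v9 antecedents: F1 and the textbook LSI. For a complete
connected non-compact non-flat normalised 4-d shrinker with bounded non-decaying scalar curvature there is a
complete connected non-flat normalised 3-d shrinker `(N, h, φ)` with `∫_M e^{-f} ≤ 2√π ∫_N e^{-φ}`: F1 supplies `N`
and the transplants; U2 (landed, over `R ≥ 0`) the cut-offs on `N × ℝ`, U3 (landed, fact-free) the admissible `η`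
and the test function on `M`, U1-ff (landed, over `R ≥ 0` and CN-ff ⇐ BE) the LSI on `M`; `ε → 0`; both integrals
finite and positive by Carrillo–Ni (i) (a theorem: `carrilloNi_integrable_exp_neg`).
[cite: BernsteinWang2016, Thm 1.2, Cor 6.6] [cite: MunteanuWang2019, proof of Thm 5.1 (p. 21)] -/
theorem collapsedDirectionReduction_of_textbook (hsplit : shrinkerSplittingAtInfinity_four)
    (hBE : bakryEmery_logSobolev_complete)
    (M : Type) [TopologicalSpace M] [T2Space M] [SecondCountableTopology M]
    [ChartedSpace (EuclideanSpace ℝ (Fin 4)) M] [IsManifold (𝓡 4) ∞ M] [ConnectedSpace M] [NoncompactSpace M]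
    [T3Space M] [MeasurableSpace M] [BorelSpace M]
    (g : PseudoRiemannianMetric (𝓡 4) ∞ (EuclideanSpace ℝ (Fin 4)) (TangentSpace (𝓡 4) : M → Type _))
    [g.HasLeviCivita] (f : M → ℝ) (hg : g.IsRiemannian)
    (hc : ∀ (x : M) (r : NNReal), IsCompact {y : M | g.edist hg x y ≤ r})
    (hf : ContMDiff (𝓡 4) 𝓘(ℝ, ℝ) ∞ f)
    (hsol : ∀ (x : M) (X Y : TangentSpace (𝓡 4) x),
      g.ricci x X Y + g.hessian f x X Y = (1 / 2 : ℝ) * g.val x X Y)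
    (hnorm : ∀ x : M, g.scalarCurvature x + g.gradSq f x = f x)
    (hnf : ∃ x : M, g.scalarCurvature x ≠ 0)
    (hbdd : ∃ C : ℝ, ∀ x : M, g.scalarCurvature x ≤ C)
    (hnd : ∃ ε : ℝ, 0 < ε ∧ ∀ K : Set M, IsCompact K → ∃ x, x ∉ K ∧ ε ≤ g.scalarCurvature x) :
    ∃ (N : Type) (_ : TopologicalSpace N) (_ : T2Space N) (_ : SecondCountableTopology N)
      (_ : ChartedSpace (EuclideanSpace ℝ (Fin 3)) N) (_ : IsManifold (𝓡 3) ∞ N)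
      (_ : ConnectedSpace N) (_ : T3Space N) (_ : MeasurableSpace N) (_ : BorelSpace N)
      (h : PseudoRiemannianMetric (𝓡 3) ∞ (EuclideanSpace ℝ (Fin 3)) (TangentSpace (𝓡 3) : N → Type _))
      (_ : h.HasLeviCivita) (φ : N → ℝ) (hh : h.IsRiemannian),
      (∀ (y : N) (r : NNReal), IsCompact {z : N | h.edist hh y z ≤ r}) ∧
      ContMDiff (𝓡 3) 𝓘(ℝ, ℝ) ∞ φ ∧
      (∀ (y : N) (X Y : TangentSpace (𝓡 3) y),
        h.ricci y X Y + h.hessian φ y X Y = (1 / 2 : ℝ) * h.val y X Y) ∧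
      (∀ y : N, h.scalarCurvature y + h.gradSq φ y = φ y) ∧
      (∃ y : N, h.scalarCurvature y ≠ 0) ∧
      ∫⁻ x, ENNReal.ofReal (Real.exp (-f x)) ∂(riemannianMeasure (g.toContMDiffRiemannianMetric hg)) ≤
        ENNReal.ofReal (2 * Real.sqrt Real.pi) *
          ∫⁻ y, ENNReal.ofReal (Real.exp (-φ y)) ∂(riemannianMeasure (h.toContMDiffRiemannianMetric hh)) := by
  obtain ⟨N, tN, t2N, scN, chN, mN, cN, t3N, msN, bN, h, lcN, φ, hh, hcN, hφ, hsolN, hnormN, hnfN,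
    htrans⟩ := hsplit M g f hg hc hf hsol hnorm hnf hbdd hnd
  refine ⟨N, tN, t2N, scN, chN, mN, cN, t3N, msN, bN, h, lcN, φ, hh, hcN, hφ, hsolN, hnormN, hnfN, ?_⟩
  have hX := shrinkerScalarCurvature_nonneg_holds
  have hCNff := shrinkerLSI_ff hBE
  -- Carrillo–Ni (i) on `M` (`n = 4`) and on `N` (`n = 3`) — theorems
  have hAi : Integrable (fun x ↦ Real.exp (-f x)) g.riemVolume :=
    NoncompactShrinkerGapCarrilloNiClauses.carrilloNi_integrable_exp_neg g f hg hc hf hsol hnorm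
  have hBi : Integrable (fun y ↦ Real.exp (-φ y)) h.riemVolume :=
    NoncompactShrinkerGapCarrilloNiClauses.carrilloNi_integrable_exp_neg h φ hh hcN hφ hsolN hnormN
  have hApos : 0 < ∫ x, Real.exp (-f x) ∂g.riemVolume := integral_exp_neg_pos hg hAi
  have hBpos : 0 < ∫ y, Real.exp (-φ y) ∂h.riemVolume := integral_exp_neg_pos hh hBi
  have h2sqrtpi : 0 < 2 * Real.sqrt Real.pi := by positivity
  have hapos : 0 < (4 * Real.pi) ^ (-(4 : ℝ) / 2) := Real.rpow_pos_of_pos (by positivity) _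
  -- the real inequality `∫_M e^{-f} ≤ 2√π ∫_N e^{-φ}` from U1-ff, U2, U3, `ε` at a time
  have hmain : ∫ x, Real.exp (-f x) ∂g.riemVolume ≤
      2 * Real.sqrt Real.pi * ∫ y, Real.exp (-φ y) ∂h.riemVolume := by
    refine le_of_forall_log_mul_le hapos hApos (mul_pos h2sqrtpi hBpos) fun ε hε ↦ ?_
    obtain ⟨R, W, hWs, hWc, hWsupp, hWZ, hWval⟩ :=
      NoncompactShrinkerGapModelValueSplitLineOfNonneg.stub_modelValueSplitLine_of_nonneg hX N h φ hh hcN hφ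
        hsolN hnormN ε hε
    obtain ⟨η, hη, hη'⟩ :=
      NoncompactShrinkerGapTransplantComparison.stub_transplantComparison M g hg N h hh φ R W hWs hWc hWsupp
        hWZ ε hε
    obtain ⟨U, Φ, Ψ, hU, hsub, hΦ, hΦU, hΨ, hinv, hqi, hscal⟩ := htrans R η hη
    obtain ⟨w, hws, hwc, hwZ, hwval⟩ := hη' U Φ Ψ hU hsub hΦ hΦU hΨ hinv hqi hscal
    have h1 := NoncompactShrinkerGapCompactSupportLSIOfLSI.stub_compactSupportLSI_of_lsi hX hCNff M g f hg hc
      hf hsol hnorm hbdd w hws hwc hwZ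
    linarith
  -- conversion to the route's `lintegral`s
  rw [lintegral_exp_neg_eq_ofReal_integral hg hAi, lintegral_exp_neg_eq_ofReal_integral hh hBi,
    ← ENNReal.ofReal_mul h2sqrtpi.le]
  exact ENNReal.ofReal_le_ofReal hmain

/-- **The crux on the bounded-curvature non-conical class, modulo F3, F1 and the textbook LSI**: the 3-d rung
(`stub_threeShrinkerGap_of_classification` from F3: `∫_N e^{-φ} ≤ 16π²e^{-3/2}`) composed with the lever:
`∫_M e^{-f} ≤ 2√π · 16π² e^{-3/2} = 32π²√π e^{-3/2}`. [cite: BernsteinWang2016, Thm 1.2] -/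
theorem nonDecayingGap_of_textbook (hcl : threeShrinkerClassification_modelData)
    (hsplit : shrinkerSplittingAtInfinity_four) (hBE : bakryEmery_logSobolev_complete)
    (M : Type) [TopologicalSpace M] [T2Space M] [SecondCountableTopology M]
    [ChartedSpace (EuclideanSpace ℝ (Fin 4)) M] [IsManifold (𝓡 4) ∞ M] [ConnectedSpace M] [NoncompactSpace M]
    [T3Space M] [MeasurableSpace M] [BorelSpace M]
    (g : PseudoRiemannianMetric (𝓡 4) ∞ (EuclideanSpace ℝ (Fin 4)) (TangentSpace (𝓡 4) : M → Type _))
    [g.HasLeviCivita] (f : M → ℝ) (hg : g.IsRiemannian)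
    (hc : ∀ (x : M) (r : NNReal), IsCompact {y : M | g.edist hg x y ≤ r})
    (hf : ContMDiff (𝓡 4) 𝓘(ℝ, ℝ) ∞ f)
    (hsol : ∀ (x : M) (X Y : TangentSpace (𝓡 4) x),
      g.ricci x X Y + g.hessian f x X Y = (1 / 2 : ℝ) * g.val x X Y)
    (hnorm : ∀ x : M, g.scalarCurvature x + g.gradSq f x = f x)
    (hnf : ∃ x : M, g.scalarCurvature x ≠ 0)
    (hbdd : ∃ C : ℝ, ∀ x : M, g.scalarCurvature x ≤ C)
    (hnd : ∃ ε : ℝ, 0 < ε ∧ ∀ K : Set M, IsCompact K → ∃ x, x ∉ K ∧ ε ≤ g.scalarCurvature x) :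
    ∫⁻ x, ENNReal.ofReal (Real.exp (-f x)) ∂(riemannianMeasure (g.toContMDiffRiemannianMetric hg)) ≤
      ENNReal.ofReal (32 * Real.pi ^ 2 * Real.sqrt Real.pi * Real.exp (-(3 : ℝ) / 2)) := by
  obtain ⟨N, _, _, _, _, _, _, _, _, _, h, _, φ, hh, hcN, hφ, hsolN, hnormN, hnfN, hZ⟩ :=
    collapsedDirectionReduction_of_textbook hsplit hBE M g f hg hc hf hsol hnorm hnf hbdd hnd
  have h3 : ∫⁻ x, ENNReal.ofReal (Real.exp (-φ x)) ∂(riemannianMeasure (h.toContMDiffRiemannianMetric hh))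
      ≤ ENNReal.ofReal (16 * Real.pi ^ 2 * Real.exp (-(3 : ℝ) / 2)) :=
    NoncompactShrinkerGapThreeShrinkerGap.stub_threeShrinkerGap_of_classification hcl N h φ hh hcN hφ hsolN
      hnormN hnfN
  calc ∫⁻ x, ENNReal.ofReal (Real.exp (-f x)) ∂(riemannianMeasure (g.toContMDiffRiemannianMetric hg))
      ≤ ENNReal.ofReal (2 * Real.sqrt Real.pi) * ∫⁻ x, ENNReal.ofReal (Real.exp (-φ x))
          ∂(riemannianMeasure (h.toContMDiffRiemannianMetric hh)) := hZ
    _ ≤ ENNReal.ofReal (2 * Real.sqrt Real.pi) * ENNReal.ofReal (16 * Real.pi ^ 2 * Real.exp (-(3 : ℝ) / 2)) := by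
        gcongr
    _ = ENNReal.ofReal (32 * Real.pi ^ 2 * Real.sqrt Real.pi * Real.exp (-(3 : ℝ) / 2)) :=
        lineFactor_mul_threeBound

/-- **The crux from the three facts and the two residues** (trichotomy on `R` at infinity: unbounded — residue;
bounded non-decaying — `nonDecayingGap_of_textbook`; bounded decaying — the conical residue). -/
theorem noncompactShrinkerGap_of_textbook_and_residues (hcl : threeShrinkerClassification_modelData)
    (hsplit : shrinkerSplittingAtInfinity_four) (hBE : bakryEmery_logSobolev_complete)
    (hC : ∀ (M : Type) [TopologicalSpace M] [T2Space M] [SecondCountableTopology M] [ChartedSpace (EuclideanSpace ℝ (Fin 4)) M] [IsManifold (𝓡 4) ∞ M] [ConnectedSpace M] [NoncompactSpace M] [T3Space M] [MeasurableSpace M] [BorelSpace M] (g : PseudoRiemannianMetric (𝓡 4) ∞ (EuclideanSpace ℝ (Fin 4)) (TangentSpace (𝓡 4) : M → Type _)) [g.HasLeviCivita] (f : M → ℝ) (hg : g.IsRiemannian), (∀ (x : M) (r : NNReal), IsCompact {y : M | g.edist hg x y ≤ r}) → ContMDiff (𝓡 4) 𝓘(ℝ, ℝ) ∞ f → (∀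 (x : M) (X Y : TangentSpace (𝓡 4) x), g.ricci x X Y + g.hessian f x X Y = (1 / 2 : ℝ) * g.val x X Y) → (∀ x : M, g.scalarCurvature x + g.gradSq f x = f x) → (∃ x : M, g.scalarCurvature x ≠ 0) → (∀ ε : ℝ, 0 < ε → ∃ K : Set M, IsCompact K ∧ ∀ x, x ∉ K → g.scalarCurvature x < ε) → ∫⁻ x, ENNReal.ofReal (Real.exp (-f x)) ∂(riemannianMeasure (g.toContMDiffRiemannianMetric hg)) ≤ ENNReal.ofReal (32 * Real.pi ^ 2 * Real.sqrt Real.pi * Real.exp (-(3 : ℝ) / 2)))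
    (hD : ∀ (M : Type) [TopologicalSpace M] [T2Space M] [SecondCountableTopology M] [ChartedSpace (EuclideanSpace ℝ (Fin 4)) M] [IsManifold (𝓡 4) ∞ M] [ConnectedSpace M] [NoncompactSpace M] [T3Space M] [MeasurableSpace M] [BorelSpace M] (g : PseudoRiemannianMetric (𝓡 4) ∞ (EuclideanSpace ℝ (Fin 4)) (TangentSpace (𝓡 4) : M → Type _)) [g.HasLeviCivita] (f : M → ℝ) (hg : g.IsRiemannian), (∀ (x : M) (r : NNReal), IsCompact {y : M | g.edist hg x y ≤ r}) → ContMDiff (𝓡 4) 𝓘(ℝ, ℝ) ∞ f → (∀ (x : M) (X Y : TangentSpace (𝓡 4) x), g.ricci x X Y + g.hessian f x X Y = (1 / 2 : ℝ) * g.val x X Y) → (∀ x : M, g.scalarCurvature x + g.gradSq f x = f x) → (∃ x : M, g.scalarCurvature x ≠ 0) → (¬ ∃ C : ℝ, ∀ x : M, g.scalarCurvature x ≤ C) → ∫⁻ x, ENNReal.ofReal (Real.exp (-f x)) ∂(riemannianMeasure (g.toContMDiffRiemannianMetric hg)) ≤ ENNReal.ofReal (32 * Real.pi ^ 2 * Real.sqrt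 Real.pi * Real.exp (-(3 : ℝ) / 2))) :
    Summit.SmoothPoincare4.SmoothPoincare4.Theses.EntropyRung.NoncompactShrinkerGap := by
  intro M _ _ _ _ _ _ _ _ _ _ g _ f hg hc hf hsol hnorm hnf
  by_cases hbdd : ∃ C : ℝ, ∀ x : M, g.scalarCurvature x ≤ C
  · by_cases hflat : ∀ ε : ℝ, 0 < ε → ∃ K : Set M, IsCompact K ∧ ∀ x, x ∉ K → g.scalarCurvature x < ε
    · exact hC M g f hg hc hf hsol hnorm hnf hflat
    · exact nonDecayingGap_of_textbook hcl hsplit hBE M g f hg hc hf hsol hnorm hnf hbdd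
        (exists_nondecaying_of_not_flatAtInfinity hflat)
  · exact hD M g f hg hc hf hsol hnorm hnf hbdd

/-! ## The registered helpers (the textbook LSI written out = `bakryEmery_logSobolev_complete` unfolded) -/

/-- Registered helper `helper_nonDecayingGap_of_textbook` (line `collapsed-ends-usc`, skeleton v9): the crux on
the bounded-curvature non-conical class modulo F3, F1 and the textbook Bakry–Émery LSI. -/
theorem helper_nonDecayingGap_of_textbook : Literature.Geometry.Riemannian.threeShrinkerClassification_modelData → Literature.Geometry.Riemannian.shrinkerSplittingAtInfinity_four → (∀ (n : ℕ) (M : Type) [TopologicalSpace M] [T2Space M] [SecondCountableTopology M] [ChartedSpace (EuclideanSpace ℝ (Fin n)) M] [IsManifold (𝓡 n) ∞ M] [ConnectedSpace M] [T3Space M] [MeasurableSpace M] [BorelSpace M] (g : PseudoRiemannianMetric (𝓡 n) ∞ (EuclideanSpace ℝ (Fin n)) (TangentSpace (𝓡 n) : M → Type _)) [g.HasLeviCivita] (V : M → ℝ) (K : ℝ), g.IsRiemannian → (∀ (x : M) (r : NNReal), IsCompact {y : M | g.riemEDist x y ≤ r}) → ContMDiff (𝓡 n) 𝓘(ℝ,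 ℝ) ∞ V → 0 < K → (∀ (x : M) (X : TangentSpace (𝓡 n) x), K * g.val x X X ≤ g.ricci x X X + g.hessian V x X X) → ∫ x, Real.exp (-V x) ∂g.riemVolume = 1 → ∀ φ : M → ℝ, ContMDiff (𝓡 n) 𝓘(ℝ, ℝ) ∞ φ → ∫ x, Real.exp (φ x) * Real.exp (-V x) ∂g.riemVolume = 1 → (∃ o : M, Integrable (fun x ↦ (g.riemEDist o x).toReal ^ 2 * (Real.exp (φ x) * Real.exp (-V x))) g.riemVolume) → Integrable (fun x ↦ g.gradSq φ x * (Real.exp (φ x) * Real.exp (-V x))) g.riemVolume → ∫ x, φ x * (Real.exp (φ x) * Real.exp (-V x)) ∂g.riemVolume ≤ 1 / (2 * K) * ∫ x, g.gradSq φ x * (Real.exp (φ x) * Real.exp (-V x)) ∂g.riemVolume) → ∀ (M : Type) [TopologicalSpace M] [T2Space M] [SecondCountableTopology M] [ChartedSpace (EuclideanSpace ℝ (Fin 4)) M] [IsManifold (𝓡 4) ∞ M] [ConnectedSpace M] [NoncompactSpace M] [T3Space M] [MeasurableSpace M] [BorelSpace M] (g : PseudoRiemannianMetric (𝓡 4)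 ∞ (EuclideanSpace ℝ (Fin 4)) (TangentSpace (𝓡 4) : M → Type _)) [g.HasLeviCivita] (f : M → ℝ) (hg : g.IsRiemannian), (∀ (x : M) (r : NNReal), IsCompact {y : M | g.edist hg x y ≤ r}) → ContMDiff (𝓡 4) 𝓘(ℝ, ℝ) ∞ f → (∀ (x : M) (X Y : TangentSpace (𝓡 4) x), g.ricci x X Y + g.hessian f x X Y = (1 / 2 : ℝ) * g.val x X Y) → (∀ x : M, g.scalarCurvature x + g.gradSq f x = f x) → (∃ x : M, g.scalarCurvature x ≠ 0) → (∃ C : ℝ, ∀ x : M, g.scalarCurvature x ≤ C) → (∃ ε : ℝ, 0 < ε ∧ ∀ K : Set M, IsCompact K → ∃ x, x ∉ K ∧ ε ≤ g.scalarCurvature x) → ∫⁻ x, ENNReal.ofReal (Real.exp (-f x)) ∂(riemannianMeasure (g.toContMDiffRiemannianMetric hg)) ≤ ENNReal.ofReal (32 * Real.pi ^ 2 * Real.sqrt Real.pi * Real.exp (-(3 : ℝ) / 2)) :=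
  nonDecayingGap_of_textbook

/-- Registered helper `helper_noncompactShrinkerGap_of_textbook` (line `collapsed-ends-usc`, skeleton v9): the crux
from F3, F1, the textbook Bakry–Émery LSI and the two residues. -/
theorem helper_noncompactShrinkerGap_of_textbook : Literature.Geometry.Riemannian.threeShrinkerClassification_modelData → Literature.Geometry.Riemannian.shrinkerSplittingAtInfinity_four → (∀ (n : ℕ) (M : Type) [TopologicalSpace M] [T2Space M] [SecondCountableTopology M] [ChartedSpace (EuclideanSpace ℝ (Fin n)) M] [IsManifold (𝓡 n) ∞ M] [ConnectedSpace M] [T3Space M] [MeasurableSpace M] [BorelSpace M] (g : PseudoRiemannianMetric (𝓡 n) ∞ (EuclideanSpace ℝ (Fin n)) (TangentSpace (𝓡 n) : M → Type _)) [g.HasLeviCivita] (V : M → ℝ) (K : ℝ), g.IsRiemannian → (∀ (x : M) (r : NNReal), IsCompact {y : M | g.riemEDist x y ≤ r}) → ContMDiff (𝓡 n) 𝓘(ℝ, ℝ) ∞ V → 0 < K → (∀ (x : M) (X : TangentSpace (𝓡 n) x), K * g.val x X X ≤ g.ricci x X X + g.hessian V x X X) → ∫ x, Real.exp (-V x) ∂g.riemVolume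 = 1 → ∀ φ : M → ℝ, ContMDiff (𝓡 n) 𝓘(ℝ, ℝ) ∞ φ → ∫ x, Real.exp (φ x) * Real.exp (-V x) ∂g.riemVolume = 1 → (∃ o : M, Integrable (fun x ↦ (g.riemEDist o x).toReal ^ 2 * (Real.exp (φ x) * Real.exp (-V x))) g.riemVolume) → Integrable (fun x ↦ g.gradSq φ x * (Real.exp (φ x) * Real.exp (-V x))) g.riemVolume → ∫ x, φ x * (Real.exp (φ x) * Real.exp (-V x)) ∂g.riemVolume ≤ 1 / (2 * K) * ∫ x, g.gradSq φ x * (Real.exp (φ x) * Real.exp (-V x)) ∂g.riemVolume) → (∀ (M : Type) [TopologicalSpace M] [T2Space M] [SecondCountableTopology M] [ChartedSpace (EuclideanSpace ℝ (Fin 4)) M] [IsManifold (𝓡 4) ∞ M] [ConnectedSpace M] [NoncompactSpace M] [T3Space M] [MeasurableSpace M] [BorelSpace M] (g : PseudoRiemannianMetric (𝓡 4) ∞ (EuclideanSpace ℝ (Fin 4)) (TangentSpace (𝓡 4) : M → Type _)) [g.HasLeviCivita] (f : M → ℝ) (hg : g.IsRiemannian), (∀ (x : M) (r : NNReal), IsCompact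 {y : M | g.edist hg x y ≤ r}) → ContMDiff (𝓡 4) 𝓘(ℝ, ℝ) ∞ f → (∀ (x : M) (X Y : TangentSpace (𝓡 4) x), g.ricci x X Y + g.hessian f x X Y = (1 / 2 : ℝ) * g.val x X Y) → (∀ x : M, g.scalarCurvature x + g.gradSq f x = f x) → (∃ x : M, g.scalarCurvature x ≠ 0) → (∀ ε : ℝ, 0 < ε → ∃ K : Set M, IsCompact K ∧ ∀ x, x ∉ K → g.scalarCurvature x < ε) → ∫⁻ x, ENNReal.ofReal (Real.exp (-f x)) ∂(riemannianMeasure (g.toContMDiffRiemannianMetric hg)) ≤ ENNReal.ofReal (32 * Real.pi ^ 2 * Real.sqrt Real.pi * Real.exp (-(3 : ℝ) / 2))) → (∀ (M : Type) [TopologicalSpace M] [T2Space M] [SecondCountableTopology M] [ChartedSpace (EuclideanSpace ℝ (Fin 4)) M] [IsManifold (𝓡 4) ∞ M] [ConnectedSpace M] [NoncompactSpace M] [T3Space M] [MeasurableSpace M] [BorelSpace M] (g : PseudoRiemannianMetric (𝓡 4) ∞ (EuclideanSpace ℝ (Fin 4)) (TangentSpace (𝓡 4) : M → Type _)) [g.HasLeviCivita]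 (f : M → ℝ) (hg : g.IsRiemannian), (∀ (x : M) (r : NNReal), IsCompact {y : M | g.edist hg x y ≤ r}) → ContMDiff (𝓡 4) 𝓘(ℝ, ℝ) ∞ f → (∀ (x : M) (X Y : TangentSpace (𝓡 4) x), g.ricci x X Y + g.hessian f x X Y = (1 / 2 : ℝ) * g.val x X Y) → (∀ x : M, g.scalarCurvature x + g.gradSq f x = f x) → (∃ x : M, g.scalarCurvature x ≠ 0) → (¬ ∃ C : ℝ, ∀ x : M, g.scalarCurvature x ≤ C) → ∫⁻ x, ENNReal.ofReal (Real.exp (-f x)) ∂(riemannianMeasure (g.toContMDiffRiemannianMetric hg)) ≤ ENNReal.ofReal (32 * Real.pi ^ 2 * Real.sqrt Real.pi * Real.exp (-(3 : ℝ) / 2))) → Summit.SmoothPoincare4.SmoothPoincare4.Theses.EntropyRung.NoncompactShrinkerGap :=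
  noncompactShrinkerGap_of_textbook_and_residues

end Summit.SmoothPoincare4.SmoothPoincare4.Theorems.NoncompactShrinkerGapReductionTextbook

end
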